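import Summits.QuantumFields.YangMills.Theorems.UnitScaleTiltProp8HalvingELMinimality
import HarnessLib

/-!
# Route `UnitScaleTilt`, crux K1 child «MinimiserStabilityRegPr» (stmt-QuantumFields-19200), registered stub V2′ `stub_halvingStep`
# (skeletons v8 5b4e846794b80374 ∕ v10 `BirthV10`) — **CRITICALITY OF THE DRESSED FUNCTIONAL `𝔊 = 𝒮_η ∘ (1 − H∘D)` AND ITS CURRENT
# `W = W₀∘(1 − H∘D) + E` WITH `E` EXPLICIT** (owner MAP #3 row M2 (H-CE), part (a): the closable half of the dressing letter; seat w5 g3 LOCATE 04:38Z)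

Cell `ym3-torus` (HUMAN RULING D-0037, YM ladder rung R3 — continuum SU(2) YM₃ on the torus is a RUNG, not the Clay problem), width seat
`ym-ust-19200-w5` gen 3 (P3b∕P5 lineage).  `--supports stmt-QuantumFields-19200 --as helper`; def-free, 0 sorry, standard axioms.

WHY.  The (165)-A₁ row of the halving package is BY NAME (✓ p603846 `HalvingA1Row165TraceAnyW.row165_of_tracePairing_L5_anyW`) modulo its hypothesis
(i) «the trace pairing of `(A′, W A′)` vanishes on `ker Q` at the test fields `s•E`» for the current `W` whose (98) letter is consumed; ✓ p604227
`HalvingELMinimality.tracePairing_of_isMinOn` supplies (i) from a constrained minimum — but for the UNDRESSED chart `↑(U X)(b) = e^{iηX(b)}` and the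
UNDRESSED Wilson functional `𝒮_η`.  The minimiser of record minimises the DRESSED functional: print p. 302, *«we make the change of variables
A = A′ − HD(A′) … 𝔊(A′) = ½⟨A′ − HD(A′), ∂*∂(A′ − HD(A′))⟩ + V₀(A′ − HD(A′)) (157) … The image of U′_k is a minimum of 𝔊(A′), thus representing it as
A₁ + HB, we obtain Eq. (143) for A₁ … (158)»*, and the current in (158) is `(δ/δA′)V` of (80) — the pure-action gradient `W₀` DRESSED by the (85)–(89)
terms.  ✓ p598408 `FlatProp4Dressing` composes the (98) LETTERS for `W = W₀∘(1 − HD) + E` with `E` an abstract letter; THIS FILE pins `E` (chain rule) and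
supplies hypothesis (i) for the dressed `W` from a constrained minimum of `𝔊`.

WHAT THIS FILE PROVES (every `Params` `P`, level-0 bonds, `M₂(ℂ)`-valued fields; `H` ANY ℂ-linear map from index data `β′ → M₂(ℂ)` to fields, `D` ANY map
to index data, differentiable at the point; `S` ANY functional with a gradient identity of the shape of ✓ p598803 `FlatActionGradient.exists_gradient_action`):
* §1 `sum_units_apply`, `field_eq_sum_units` (expansion in the matrix units `Pi.single b (Matrix.single j i 1)`), **`trace_pairing_riesz`** — every ℂ-linear
  functional `ℓ` on fields is `δ ↦ Σ_b tr(Z_b δ_b)` with `Z_b = (ℓ(e_{b,ji}))_{ij}` (the transpose for the bilinear trace pairing of p. 278 (5)∕p. 282 (27)).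
* §2 **`fderiv_dressed_apply`** (chain rule: `D𝔊(A′)[δ] = D𝒮(ΨA′)[δ − H(D′(A′)δ)]`, `Ψ = 1 − H∘D`) and **`fderiv_dressed_eq_pairing`**: for `η ≠ 0`,
  `fderiv ℂ (S ∘ Ψ) A′ δ = (η²/2)Σ_p tr(Φ_p(A′)Φ_p(δ)) + η⁴Σ_b tr(W(A′)_b δ_b)` with `W Y = W₀(ΨY) + E Y` and `E` EXPLICIT:
  `E Y b = (η⁻⁴·ℓ_Y(e_{b,ji}))_{ij}`, `ℓ_Y(ε) = −(η²/2)Σ_p tr(Φ_p(H(D Y))Φ_p(ε)) − (η²/2)Σ_p tr(Φ_p(ΨY)Φ_p(H(D′(Y)ε))) − η⁴Σ_b tr(W₀(ΨY)_b (H(D′(Y)ε))_b)`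
  (`D′(Y) = fderiv ℂ D Y`) — the three (85)–(89)-type terms `E₁ = −½(∂*∂)_c(HD)`, `E₂ = −T_Yᵀ[½(∂*∂)_c(ΨY)]`, `E₃ = −T_Yᵀ[W₀(ΨY)]`, `T_Y = H∘D′(Y)`, at `J = 0`.
* §3 **`tracePairing_of_isMinOn_dressed`** — at a minimiser `A` of `X ↦ Re S(X − H(D X))` over ★w3's competitor set
  `T = {X | X bondwise self-adjoint ∧ (∀ c, Q_{j(c)}X(c) = B(c)) ∧ X ∈ S₀}` (`S₀` open along lines through `A`): hypothesis (i) of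
  `row165_of_tracePairing_L5_anyW` VERBATIM for the dressed current `W`; **`tracePairing_of_isMinOn_dressed_wilson`** — the same from a minimum of the
  tree's `wilsonAction4 ∘ U` for a chart `U` with `↑(U X)(b) = e^{iη(X − H(D X))(b)}` on `T` (`S = 𝒮_η`, ✓ `FlatActionGradient.wilsonAction4_eq_re_action`).
HONEST SCOPE.  Exact first-order calculus and finite-dimensional linear algebra; NO estimate: the dressing letter `C_E` of p598408 for THIS `E` needs the sharp
second-order row of `H` ([5] (3.132)) and the (73)-type transpose letters of `D′` (seat LOCATE 04:38Z, rows (X1)∕(X2)) and is NOT proved here; the minimiser, the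
chart, `H`, `D` are hypotheses.  NOT a claim about the stub, the crux, the rung or the mass gap.

References: T. Bałaban, CMP **102** (1985) 277–309 [Balaban1985Variational] (5) p.278, (27) p.282, (47) p.285, (80)–(89) pp.290–291, (99)–(100) p.293,
(127) p.297, (157)–(158) p.302.
-/

set_option autoImplicit false

noncomputable section

open scoped BigOperators Matrix Matrix.Norms.L2Operator
open NormedSpace

namespace Summit.QuantumFields.YangMills.Theorems.HalvingDressedCriticality

open Literature.MathematicalPhysics.QuantumFieldTheory.Balaban1983to89
open B6SectADomainsV1 (Domains)
open B6SectAOperatorsV1 (BondIdx QE QE_apply)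
open LatticeFieldCalculus (bondAvgIter)
open Literature.MathematicalPhysics.QuantumFieldTheory.BalabanImbrieJaffe1984to88.BIJ85AxialPropagator411 (bondAvgIter_add bondAvgIter_smul)
open FlatActionCritical (re_fderiv_eq_zero_of_isMinOn_segment)
open FlatActionGradient (wilsonAction4_eq_re_action)

/-! ## §1 Matrix units and the Riesz representation for the trace pairing -/

section Riesz

variable {ι : Type*} [Fintype ι] [DecidableEq ι] {n : Type*} [Fintype n] [DecidableEq n]

/-- The matrix-unit expansion read at a bond: `(Σ_{b,i,j} δ_b(j,i)•e_{b,(j,i)})(b′) = δ(b′)`. [folklore] -/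
theorem sum_units_apply (δ : ι → Matrix n n ℂ) (b' : ι) :
    (∑ b, ∑ i, ∑ j, δ b j i • (Pi.single b (Matrix.single j i (1 : ℂ)) : ι → Matrix n n ℂ)) b' = δ b' := by
  rw [Finset.sum_apply, Finset.sum_eq_single b']
  · simp only [Finset.sum_apply, Pi.smul_apply, Pi.single_eq_same, Matrix.smul_single, smul_eq_mul, mul_one]
    rw [Finset.sum_comm]
    exact (Matrix.matrix_eq_sum_single (δ b')).symm
  · intro b _ hb
    simp only [Finset.sum_apply, Pi.smul_apply, Pi.single_eq_of_ne' hb, smul_zero, Finset.sum_const_zero]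
  · intro h; exact absurd (Finset.mem_univ _) h

/-- Expansion of a matrix field in the matrix units `e_{b,(j,i)} = Pi.single b (Matrix.single j i 1)`. [folklore] -/
theorem field_eq_sum_units (δ : ι → Matrix n n ℂ) :
    δ = ∑ b, ∑ i, ∑ j, δ b j i • (Pi.single b (Matrix.single j i (1 : ℂ)) : ι → Matrix n n ℂ) :=
  funext fun b' => (sum_units_apply δ b').symm

/-- **RIESZ FOR THE TRACE PAIRING**: a ℂ-linear functional `ℓ` on matrix fields is the trace pairing with the field `Z_b = (ℓ(e_{b,(j,i)}))_{(i,j)}`: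
`Σ_b tr(Z_b·δ_b) = ℓ(δ)` — the transpose∕gradient for the bilinear pairing `⟨X, Y⟩ = Σ_b tr(X_bY_b)` of print. [cite: Balaban1985Variational, (5) p.278, (27) p.282] -/
theorem trace_pairing_riesz (ℓ : (ι → Matrix n n ℂ) →ₗ[ℂ] ℂ) (δ : ι → Matrix n n ℂ) :
    ∑ b, Matrix.trace ((Matrix.of fun i j => ℓ (Pi.single b (Matrix.single j i (1 : ℂ)))) * δ b) = ℓ δ := by
  conv_rhs => rw [field_eq_sum_units δ]
  simp only [map_sum, map_smul, smul_eq_mul]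
  refine Finset.sum_congr rfl fun b _ => ?_
  simp only [Matrix.trace, Matrix.diag_apply, Matrix.mul_apply, Matrix.of_apply]
  refine Finset.sum_congr rfl fun i _ => Finset.sum_congr rfl fun j _ => ?_
  ring

end Riesz

/-! ## §2 The chain rule for `𝔊 = S ∘ (1 − H∘D)` and the dressed current -/

section ChainRule

variable {P : Params} {β' : Type*} [Fintype β']

/-- **CHAIN RULE**: `D(S∘Ψ)(A′)[δ] = DS(ΨA′)[δ − H(D′(A′)δ)]` for `Ψ(X) = X − H(D X)`, `H` ℂ-linear, `D` differentiable at `A′`, `S` differentiable at `ΨA′`.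
[cite: Balaban1985Variational, (47) p.285, (84) p.290] -/
theorem fderiv_dressed_apply (S : (PBond P 0 → Matrix (Fin 2) (Fin 2) ℂ) → ℂ)
    (H : (β' → Matrix (Fin 2) (Fin 2) ℂ) →ₗ[ℂ] (PBond P 0 → Matrix (Fin 2) (Fin 2) ℂ))
    (D : (PBond P 0 → Matrix (Fin 2) (Fin 2) ℂ) → (β' → Matrix (Fin 2) (Fin 2) ℂ))
    {A' : PBond P 0 → Matrix (Fin 2) (Fin 2) ℂ} (hD : DifferentiableAt ℂ D A') (hS : DifferentiableAt ℂ S (A' - H (D A')))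
    (δ : PBond P 0 → Matrix (Fin 2) (Fin 2) ℂ) :
    fderiv ℂ (fun X => S (X - H (D X))) A' δ = fderiv ℂ S (A' - H (D A')) (δ - H (fderiv ℂ D A' δ)) := by
  have hH : HasFDerivAt (fun X : PBond P 0 → Matrix (Fin 2) (Fin 2) ℂ => (LinearMap.toContinuousLinearMap H) (D X))
      ((LinearMap.toContinuousLinearMap H).comp (fderiv ℂ D A')) A' :=
    (LinearMap.toContinuousLinearMap H).hasFDerivAt.comp A' hD.hasFDerivAt
  have hΨ : HasFDerivAt (fun X : PBond P 0 → Matrix (Fin 2) (Fin 2) ℂ => X - H (D X))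
      ((ContinuousLinearMap.id ℂ _) - (LinearMap.toContinuousLinearMap H).comp (fderiv ℂ D A')) A' :=
    (hasFDerivAt_id A').sub hH
  have hcomp : HasFDerivAt (fun X : PBond P 0 → Matrix (Fin 2) (Fin 2) ℂ => S (X - H (D X)))
      ((fderiv ℂ S (A' - H (D A'))).comp ((ContinuousLinearMap.id ℂ _) - (LinearMap.toContinuousLinearMap H).comp (fderiv ℂ D A'))) A' :=
    hS.hasFDerivAt.comp A' hΨ
  rw [hcomp.fderiv]
  rfl

/-- **THE DRESSED CURRENT — (80)∕(84)–(89) AT `J = 0`, EXPLICITLY**: if `S` has the gradient identity `DS(A)[δ] = (η²/2)Σ_p tr(Φ_p(A)Φ_p(δ)) + η⁴Σ_b tr(W₀(A)_bδ_b)`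
(✓ `FlatActionGradient.exists_gradient_action`), `η ≠ 0`, `H` is ℂ-linear, `D` is differentiable at `A′`, and `E` is the field-valued map
`E Y b = (η⁻⁴·ℓ_Y(e_{b,(j,i)}))_{(i,j)}` with `ℓ_Y(ε) = −(η²/2)Σ_p tr(Φ_p(H(D Y))Φ_p(ε)) − (η²/2)Σ_p tr(Φ_p(ΨY)Φ_p(H(D′(Y)ε))) − η⁴Σ_b tr(W₀(ΨY)_b(H(D′(Y)ε))_b)`,
then `D(S∘Ψ)(A′)[δ] = (η²/2)Σ_p tr(Φ_p(A′)Φ_p(δ)) + η⁴Σ_b tr((W₀(ΨA′) + E A′)_b δ_b)` — the gradient identity of `𝔊` with the DRESSED current `W = W₀∘Ψ + E`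
(the `hW` shape of `FlatProp4Dressing.hWq_of_dressing`). [cite: Balaban1985Variational, (80) p.290, (84)-(89) pp.290-291, (157) p.302] -/
theorem fderiv_dressed_eq_pairing (η : ℝ) (hη : η ≠ 0) (S : (PBond P 0 → Matrix (Fin 2) (Fin 2) ℂ) → ℂ)
    (W₀ : (PBond P 0 → Matrix (Fin 2) (Fin 2) ℂ) → (PBond P 0 → Matrix (Fin 2) (Fin 2) ℂ))
    (hSd : Differentiable ℂ S)
    (hgrad : ∀ A δ : PBond P 0 → Matrix (Fin 2) (Fin 2) ℂ, fderiv ℂ S A δ =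
      ((η : ℂ) ^ 2 / 2) * ∑ p : Plaq P 0, Matrix.trace ((A ⟨p.src, p.μ⟩ + A ⟨p.src.shift p.μ, p.ν⟩ - A ⟨p.src.shift p.ν, p.μ⟩ - A ⟨p.src, p.ν⟩) * (δ ⟨p.src, p.μ⟩ + δ ⟨p.src.shift p.μ, p.ν⟩ - δ ⟨p.src.shift p.ν, p.μ⟩ - δ ⟨p.src, p.ν⟩)) + (η : ℂ) ^ 4 * ∑ b : PBond P 0, Matrix.trace (W₀ A b * δ b))
    (H : (β' → Matrix (Fin 2) (Fin 2) ℂ) →ₗ[ℂ] (PBond P 0 → Matrix (Fin 2) (Fin 2) ℂ))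
    (D : (PBond P 0 → Matrix (Fin 2) (Fin 2) ℂ) → (β' → Matrix (Fin 2) (Fin 2) ℂ))
    (E : (PBond P 0 → Matrix (Fin 2) (Fin 2) ℂ) → (PBond P 0 → Matrix (Fin 2) (Fin 2) ℂ))
    (hE : ∀ (Y : PBond P 0 → Matrix (Fin 2) (Fin 2) ℂ) (b : PBond P 0) (i j : Fin 2), E Y b i j = ((η : ℂ) ^ 4)⁻¹ *
      (-(((η : ℂ) ^ 2 / 2) * ∑ p : Plaq P 0, Matrix.trace ((H (D Y) ⟨p.src, p.μ⟩ + H (D Y) ⟨p.src.shift p.μ, p.ν⟩ - H (D Y) ⟨p.src.shift p.ν, p.μ⟩ - H (D Y) ⟨p.src, p.ν⟩) *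
          ((Pi.single b (Matrix.single j i (1 : ℂ)) : PBond P 0 → Matrix (Fin 2) (Fin 2) ℂ) ⟨p.src, p.μ⟩ + (Pi.single b (Matrix.single j i (1 : ℂ)) : PBond P 0 → Matrix (Fin 2) (Fin 2) ℂ) ⟨p.src.shift p.μ, p.ν⟩ -
            (Pi.single b (Matrix.single j i (1 : ℂ)) : PBond P 0 → Matrix (Fin 2) (Fin 2) ℂ) ⟨p.src.shift p.ν, p.μ⟩ - (Pi.single b (Matrix.single j i (1 : ℂ)) : PBond P 0 → Matrix (Fin 2) (Fin 2) ℂ) ⟨p.src, p.ν⟩)))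
        - ((η : ℂ) ^ 2 / 2) * ∑ p : Plaq P 0, Matrix.trace (((Y - H (D Y)) ⟨p.src, p.μ⟩ + (Y - H (D Y)) ⟨p.src.shift p.μ, p.ν⟩ - (Y - H (D Y)) ⟨p.src.shift p.ν, p.μ⟩ - (Y - H (D Y)) ⟨p.src, p.ν⟩) *
          (H (fderiv ℂ D Y (Pi.single b (Matrix.single j i (1 : ℂ)))) ⟨p.src, p.μ⟩ + H (fderiv ℂ D Y (Pi.single b (Matrix.single j i (1 : ℂ)))) ⟨p.src.shift p.μ, p.ν⟩ -
            H (fderiv ℂ D Y (Pi.single b (Matrix.single j i (1 : ℂ)))) ⟨p.src.shift p.ν, p.μ⟩ - H (fderiv ℂ D Y (Pi.single b (Matrix.single j i (1 : ℂ)))) ⟨p.src, p.ν⟩))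
        - (η : ℂ) ^ 4 * ∑ b' : PBond P 0, Matrix.trace (W₀ (Y - H (D Y)) b' * H (fderiv ℂ D Y (Pi.single b (Matrix.single j i (1 : ℂ)))) b')))
    {A' : PBond P 0 → Matrix (Fin 2) (Fin 2) ℂ} (hD : DifferentiableAt ℂ D A') (δ : PBond P 0 → Matrix (Fin 2) (Fin 2) ℂ) :
    fderiv ℂ (fun X => S (X - H (D X))) A' δ =
      ((η : ℂ) ^ 2 / 2) * ∑ p : Plaq P 0, Matrix.trace ((A' ⟨p.src, p.μ⟩ + A' ⟨p.src.shift p.μ, p.ν⟩ - A' ⟨p.src.shift p.ν, p.μ⟩ - A' ⟨p.src, p.ν⟩) * (δ ⟨p.src, p.μ⟩ + δ ⟨p.src.shift p.μ, p.ν⟩ - δ ⟨p.src.shift p.ν, p.μ⟩ - δ ⟨p.src, p.ν⟩)) +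
        (η : ℂ) ^ 4 * ∑ b : PBond P 0, Matrix.trace ((W₀ (A' - H (D A')) b + E A' b) * δ b) := by
  -- abbreviations
  set Ψ : PBond P 0 → Matrix (Fin 2) (Fin 2) ℂ := A' - H (D A') with hΨ
  set T : (PBond P 0 → Matrix (Fin 2) (Fin 2) ℂ) →ₗ[ℂ] (PBond P 0 → Matrix (Fin 2) (Fin 2) ℂ) := H ∘ₗ (fderiv ℂ D A' : (PBond P 0 → Matrix (Fin 2) (Fin 2) ℂ) →ₗ[ℂ] (β' → Matrix (Fin 2) (Fin 2) ℂ)) with hT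
  have hTapply : ∀ ε, T ε = H (fderiv ℂ D A' ε) := fun ε => rfl
  -- the plaquette form is bilinear: `Φ_p`
  let Φ : Plaq P 0 → (PBond P 0 → Matrix (Fin 2) (Fin 2) ℂ) → Matrix (Fin 2) (Fin 2) ℂ :=
    fun p X => X ⟨p.src, p.μ⟩ + X ⟨p.src.shift p.μ, p.ν⟩ - X ⟨p.src.shift p.ν, p.μ⟩ - X ⟨p.src, p.ν⟩
  have hΦ : ∀ p X, X ⟨p.src, p.μ⟩ + X ⟨p.src.shift p.μ, p.ν⟩ - X ⟨p.src.shift p.ν, p.μ⟩ - X ⟨p.src, p.ν⟩ = Φ p X := fun _ _ => rfl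
  have hΦsub : ∀ p X Y, Φ p (X - Y) = Φ p X - Φ p Y := fun p X Y => by simp only [Φ, Pi.sub_apply]; abel
  have hΦadd : ∀ p X Y, Φ p (X + Y) = Φ p X + Φ p Y := fun p X Y => by simp only [Φ, Pi.add_apply]; abel
  have hΦsmul : ∀ p (a : ℂ) X, Φ p (a • X) = a • Φ p X := fun p a X => by simp only [Φ, Pi.smul_apply, smul_add, smul_sub]
  -- the remainder functional `ℓ_{A′}` as a linear map
  let ℓ : (PBond P 0 → Matrix (Fin 2) (Fin 2) ℂ) →ₗ[ℂ] ℂ :=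
    { toFun := fun ε => -(((η : ℂ) ^ 2 / 2) * ∑ p : Plaq P 0, Matrix.trace (Φ p (H (D A')) * Φ p ε))
          - ((η : ℂ) ^ 2 / 2) * ∑ p : Plaq P 0, Matrix.trace (Φ p Ψ * Φ p (T ε))
          - (η : ℂ) ^ 4 * ∑ b' : PBond P 0, Matrix.trace (W₀ Ψ b' * T ε b')
      map_add' := fun ε ε' => by
        simp only [map_add, Pi.add_apply, hΦadd, Matrix.mul_add, Matrix.trace_add, Finset.sum_add_distrib]
        ring
      map_smul' := fun a ε => by
        simp only [map_smul, Pi.smul_apply, hΦsmul, Matrix.mul_smul, Matrix.trace_smul, smul_eq_mul, RingHom.id_apply, ← Finset.mul_sum]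
        ring }
  have hℓ : ∀ ε, ℓ ε = -(((η : ℂ) ^ 2 / 2) * ∑ p : Plaq P 0, Matrix.trace (Φ p (H (D A')) * Φ p ε))
      - ((η : ℂ) ^ 2 / 2) * ∑ p : Plaq P 0, Matrix.trace (Φ p Ψ * Φ p (T ε))
      - (η : ℂ) ^ 4 * ∑ b' : PBond P 0, Matrix.trace (W₀ Ψ b' * T ε b') := fun _ => rfl
  -- `E A′ b = (η⁻⁴·ℓ(e_{b,ji}))`
  have hEA : ∀ b, E A' b = ((η : ℂ) ^ 4)⁻¹ • Matrix.of fun i j => ℓ (Pi.single b (Matrix.single j i (1 : ℂ))) := by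
    intro b
    ext i j
    rw [hE A' b i j, Matrix.smul_apply, Matrix.of_apply, smul_eq_mul]
    rfl
  -- the pairing of `E A′` with `δ` is `ℓ δ`
  have hEpair : (η : ℂ) ^ 4 * ∑ b : PBond P 0, Matrix.trace (E A' b * δ b) = ℓ δ := by
    have hη4 : ((η : ℂ) ^ 4) ≠ 0 := pow_ne_zero _ (Complex.ofReal_ne_zero.2 hη)
    simp only [hEA, Matrix.smul_mul, Matrix.trace_smul, smul_eq_mul, ← Finset.mul_sum]
    rw [trace_pairing_riesz ℓ δ, ← mul_assoc, mul_inv_cancel₀ hη4, one_mul]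
  -- chain rule and the gradient identity at `ΨA′`
  rw [fderiv_dressed_apply S H D hD (hSd _) δ, hgrad]
  simp only [hΦ]
  rw [show A' - H (D A') = Ψ from rfl]
  -- expand and compare with `ℓ δ`
  have key : ((η : ℂ) ^ 2 / 2) * ∑ p : Plaq P 0, Matrix.trace (Φ p Ψ * Φ p (δ - H (fderiv ℂ D A' δ))) +
        (η : ℂ) ^ 4 * ∑ b : PBond P 0, Matrix.trace (W₀ Ψ b * (δ - H (fderiv ℂ D A' δ)) b) =
      ((η : ℂ) ^ 2 / 2) * ∑ p : Plaq P 0, Matrix.trace (Φ p A' * Φ p δ) +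
        ((η : ℂ) ^ 4 * ∑ b : PBond P 0, Matrix.trace (W₀ Ψ b * δ b) + ℓ δ) := by
    rw [hℓ, ← hTapply]
    have hΨA : ∀ p, Φ p Ψ = Φ p A' - Φ p (H (D A')) := fun p => by rw [hΨ, hΦsub]
    simp only [hΦsub, Pi.sub_apply, Matrix.mul_sub, Matrix.trace_sub, Finset.sum_sub_distrib]
    simp only [hΨA, Matrix.sub_mul, Matrix.trace_sub, Finset.sum_sub_distrib]
    ring
  rw [key]
  simp only [Matrix.add_mul, Matrix.trace_add, Finset.sum_add_distrib, mul_add, hEpair]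

/-- Differentiability of the dressed functional at a point where `D` is differentiable. [cite: Balaban1985Variational, (80) p.290] -/
theorem differentiableAt_dressed (S : (PBond P 0 → Matrix (Fin 2) (Fin 2) ℂ) → ℂ)
    (H : (β' → Matrix (Fin 2) (Fin 2) ℂ) →ₗ[ℂ] (PBond P 0 → Matrix (Fin 2) (Fin 2) ℂ))
    (D : (PBond P 0 → Matrix (Fin 2) (Fin 2) ℂ) → (β' → Matrix (Fin 2) (Fin 2) ℂ))
    {A' : PBond P 0 → Matrix (Fin 2) (Fin 2) ℂ} (hD : DifferentiableAt ℂ D A') (hS : DifferentiableAt ℂ S (A' - H (D A'))) :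
    DifferentiableAt ℂ (fun X => S (X - H (D X))) A' := by
  have hH : DifferentiableAt ℂ (fun X : PBond P 0 → Matrix (Fin 2) (Fin 2) ℂ => (LinearMap.toContinuousLinearMap H) (D X)) A' :=
    (LinearMap.toContinuousLinearMap H).differentiableAt.comp A' hD
  have hΨ : DifferentiableAt ℂ (fun X : PBond P 0 → Matrix (Fin 2) (Fin 2) ℂ => X - H (D X)) A' := differentiableAt_id.sub hH
  exact hS.comp A' hΨ

end ChainRule

/-! ## §3 Criticality of the dressed functional ⟹ the trace pairing on `ker Q` for the DRESSED current -/

section Minimality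

variable {P : Params} {β' : Type*} [Fintype β']

/-- **THE TRACE PAIRING ON `ker Q` FOR THE DRESSED CURRENT, FROM A CONSTRAINED MINIMUM OF THE DRESSED FUNCTIONAL** (print p. 302: *«The image of U′_k is a
minimum of 𝔊(A′) … we obtain Eq. (143) for A₁ … (158)»*): for ANY `S` with the gradient identity of `FlatActionGradient.exists_gradient_action` (current `W₀`), `η ≠ 0`,
ℂ-linear `H`, `D` differentiable at the minimiser `A`, and the explicit dressing term `E` of `fderiv_dressed_eq_pairing`: if `A` minimises `X ↦ Re S(X − H(D X))` over ★w3's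
competitor set `T = {X | X bondwise self-adjoint ∧ (∀ c, Q_{j(c)}X(c) = B(c)) ∧ X ∈ S₀}` (`S₀` open along lines through `A`), then for every real `s` with `Qs = 0` on the
index bonds and every self-adjoint `E_t` the trace pairing of `(A, W₀(A − H(D A)) + E A)` at `δ = s•E_t` has zero real part — hypothesis (i) of
`HalvingA1Row165TraceAnyW.row165_of_tracePairing_L5_anyW` VERBATIM for the DRESSED current `W Y = W₀(Y − H(D Y)) + E Y`.
[cite: Balaban1985Variational, (80) p.290, (99)-(100) p.293, (127) p.297, (157)-(158) p.302] -/
theorem tracePairing_of_isMinOn_dressed (Dm : Domains P) (η : ℝ) (hη : η ≠ 0) (S : (PBond P 0 → Matrix (Fin 2) (Fin 2) ℂ) → ℂ)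
    (W₀ : (PBond P 0 → Matrix (Fin 2) (Fin 2) ℂ) → (PBond P 0 → Matrix (Fin 2) (Fin 2) ℂ)) (hSd : Differentiable ℂ S)
    (hgrad : ∀ A δ : PBond P 0 → Matrix (Fin 2) (Fin 2) ℂ, fderiv ℂ S A δ =
      ((η : ℂ) ^ 2 / 2) * ∑ p : Plaq P 0, Matrix.trace ((A ⟨p.src, p.μ⟩ + A ⟨p.src.shift p.μ, p.ν⟩ - A ⟨p.src.shift p.ν, p.μ⟩ - A ⟨p.src, p.ν⟩) * (δ ⟨p.src, p.μ⟩ + δ ⟨p.src.shift p.μ, p.ν⟩ - δ ⟨p.src.shift p.ν, p.μ⟩ - δ ⟨p.src, p.ν⟩)) + (η : ℂ) ^ 4 * ∑ b : PBond P 0, Matrix.trace (W₀ A b * δ b))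
    (H : (β' → Matrix (Fin 2) (Fin 2) ℂ) →ₗ[ℂ] (PBond P 0 → Matrix (Fin 2) (Fin 2) ℂ))
    (D : (PBond P 0 → Matrix (Fin 2) (Fin 2) ℂ) → (β' → Matrix (Fin 2) (Fin 2) ℂ))
    (E : (PBond P 0 → Matrix (Fin 2) (Fin 2) ℂ) → (PBond P 0 → Matrix (Fin 2) (Fin 2) ℂ))
    (hE : ∀ (Y : PBond P 0 → Matrix (Fin 2) (Fin 2) ℂ) (b : PBond P 0) (i j : Fin 2), E Y b i j = ((η : ℂ) ^ 4)⁻¹ *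
      (-(((η : ℂ) ^ 2 / 2) * ∑ p : Plaq P 0, Matrix.trace ((H (D Y) ⟨p.src, p.μ⟩ + H (D Y) ⟨p.src.shift p.μ, p.ν⟩ - H (D Y) ⟨p.src.shift p.ν, p.μ⟩ - H (D Y) ⟨p.src, p.ν⟩) *
          ((Pi.single b (Matrix.single j i (1 : ℂ)) : PBond P 0 → Matrix (Fin 2) (Fin 2) ℂ) ⟨p.src, p.μ⟩ + (Pi.single b (Matrix.single j i (1 : ℂ)) : PBond P 0 → Matrix (Fin 2) (Fin 2) ℂ) ⟨p.src.shift p.μ, p.ν⟩ -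
            (Pi.single b (Matrix.single j i (1 : ℂ)) : PBond P 0 → Matrix (Fin 2) (Fin 2) ℂ) ⟨p.src.shift p.ν, p.μ⟩ - (Pi.single b (Matrix.single j i (1 : ℂ)) : PBond P 0 → Matrix (Fin 2) (Fin 2) ℂ) ⟨p.src, p.ν⟩)))
        - ((η : ℂ) ^ 2 / 2) * ∑ p : Plaq P 0, Matrix.trace (((Y - H (D Y)) ⟨p.src, p.μ⟩ + (Y - H (D Y)) ⟨p.src.shift p.μ, p.ν⟩ - (Y - H (D Y)) ⟨p.src.shift p.ν, p.μ⟩ - (Y - H (D Y)) ⟨p.src, p.ν⟩) *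
          (H (fderiv ℂ D Y (Pi.single b (Matrix.single j i (1 : ℂ)))) ⟨p.src, p.μ⟩ + H (fderiv ℂ D Y (Pi.single b (Matrix.single j i (1 : ℂ)))) ⟨p.src.shift p.μ, p.ν⟩ -
            H (fderiv ℂ D Y (Pi.single b (Matrix.single j i (1 : ℂ)))) ⟨p.src.shift p.ν, p.μ⟩ - H (fderiv ℂ D Y (Pi.single b (Matrix.single j i (1 : ℂ)))) ⟨p.src, p.ν⟩))
        - (η : ℂ) ^ 4 * ∑ b' : PBond P 0, Matrix.trace (W₀ (Y - H (D Y)) b' * H (fderiv ℂ D Y (Pi.single b (Matrix.single j i (1 : ℂ)))) b')))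
    {S₀ : Set (PBond P 0 → Matrix (Fin 2) (Fin 2) ℂ)} {Bdat : BondIdx Dm → Matrix (Fin 2) (Fin 2) ℂ}
    {A : PBond P 0 → Matrix (Fin 2) (Fin 2) ℂ} (hAsa : ∀ b, IsSelfAdjoint (A b)) (hAQ : ∀ c : BondIdx Dm, bondAvgIter (c.1.1 : ℕ) A c.1.2 = Bdat c)
    (hS₀ : ∀ δ : PBond P 0 → Matrix (Fin 2) (Fin 2) ℂ, ∃ r : ℝ, 0 < r ∧ ∀ t : ℝ, |t| < r → A + t • δ ∈ S₀)
    (hD : DifferentiableAt ℂ D A)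
    (hmin : IsMinOn (fun X => (S (X - H (D X))).re) {X : PBond P 0 → Matrix (Fin 2) (Fin 2) ℂ | (∀ b, IsSelfAdjoint (X b)) ∧ (∀ c : BondIdx Dm, bondAvgIter (c.1.1 : ℕ) X c.1.2 = Bdat c) ∧ X ∈ S₀} A) :
    ∀ s : PBond P 0 → ℝ, QE Dm (WithLp.toLp 2 s) = 0 → ∀ Et : Matrix (Fin 2) (Fin 2) ℂ, IsSelfAdjoint Et →
    (((η : ℂ) ^ 2 / 2) * ∑ p : Plaq P 0, Matrix.trace ((A ⟨p.src, p.μ⟩ + A ⟨p.src.shift p.μ, p.ν⟩ - A ⟨p.src.shift p.ν, p.μ⟩ - A ⟨p.src, p.ν⟩) * (((s ⟨p.src, p.μ⟩ : ℝ) : ℂ) • Et + ((s ⟨p.src.shift p.μ, p.ν⟩ : ℝ) : ℂ) • Et - ((s ⟨p.src.shift p.ν, p.μ⟩ : ℝ) : ℂ) • Et - ((s ⟨p.src, p.ν⟩ : ℝ) : ℂ) • Et)) +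
      (η : ℂ) ^ 4 * ∑ b : PBond P 0, Matrix.trace ((W₀ (A - H (D A)) b + E A b) * (((s b : ℝ) : ℂ) • Et))).re = 0 := by
  intro s hs Et hEt
  obtain ⟨r, hr, hSr⟩ := hS₀ (fun b => ((s b : ℝ) : ℂ) • Et)
  have hQs : ∀ c : BondIdx Dm, bondAvgIter (c.1.1 : ℕ) s c.1.2 = 0 := fun c => by
    have h := congrArg (fun v : B6SectAOperatorsV1.BondIdxSpace Dm => v c) hs
    simpa [QE_apply] using h
  have hδφ : (fun b => ((s b : ℝ) : ℂ) • Et) = fun b => (LinearMap.toSpanSingleton ℝ (Matrix (Fin 2) (Fin 2) ℂ) Et) (s b) := by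
    funext b
    rw [LinearMap.toSpanSingleton_apply, Complex.coe_smul]
  have hT : ∀ t : ℝ, |t| < r → A + t • (fun b => ((s b : ℝ) : ℂ) • Et) ∈ {X : PBond P 0 → Matrix (Fin 2) (Fin 2) ℂ | (∀ b, IsSelfAdjoint (X b)) ∧ (∀ c : BondIdx Dm, bondAvgIter (c.1.1 : ℕ) X c.1.2 = Bdat c) ∧ X ∈ S₀} := by
    intro t ht
    refine ⟨fun b => ?_, fun c => ?_, hSr t ht⟩
    · show IsSelfAdjoint (A b + t • (((s b : ℝ) : ℂ) • Et))
      rw [Complex.coe_smul]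
      exact (hAsa b).add (IsSelfAdjoint.smul (IsSelfAdjoint.all t) (IsSelfAdjoint.smul (IsSelfAdjoint.all (s b)) hEt))
    · rw [bondAvgIter_add, bondAvgIter_smul, Pi.add_apply, Pi.smul_apply, hAQ c, hδφ,
        ChartHInv.bondAvgIter_comp_apply (LinearMap.toSpanSingleton ℝ (Matrix (Fin 2) (Fin 2) ℂ) Et) (c.1.1 : ℕ) s c.1.2, hQs c, map_zero, smul_zero, add_zero]
  have hg : DifferentiableAt ℂ (fun X => S (X - H (D X))) A := differentiableAt_dressed S H D hD (hSd _)
  have key := re_fderiv_eq_zero_of_isMinOn_segment hg hr hT hmin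
  rw [fderiv_dressed_eq_pairing η hη S W₀ hSd hgrad H D E hE hD] at key
  exact key

/-- **THE SAME FROM A MINIMUM OF THE TREE'S `wilsonAction4` THROUGH THE DRESSED CHART** `↑(U X)(b) = e^{iη(X − H(D X))(b)}` on `T` (the charted competitors are
bondwise self-adjoint): `S = 𝒮_η`, `FlatActionGradient.wilsonAction4_eq_re_action`.  This is the P5 entry point: the route's minimiser read in the (47)-chart of the
cube sequence ([B8] Thm 2, P1) is such a minimum (print (157)). [cite: Balaban1985Variational, (5) p.278, (47) p.285, (157)-(158) p.302] -/
theorem tracePairing_of_isMinOn_dressed_wilson (Dm : Domains P) (η : ℝ) (hη : η ≠ 0)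
    (W₀ : (PBond P 0 → Matrix (Fin 2) (Fin 2) ℂ) → (PBond P 0 → Matrix (Fin 2) (Fin 2) ℂ)) (hSd : Differentiable ℂ (fun A : PBond P 0 → Matrix (Fin 2) (Fin 2) ℂ => (∑ p : Plaq P 0, (1 - (2 : ℂ)⁻¹ * Matrix.trace (exp ((Complex.I * (η : ℂ)) • A ⟨p.src, p.μ⟩) * exp ((Complex.I * (η : ℂ)) • A ⟨p.src.shift p.μ, p.ν⟩) * exp (-((Complex.I * (η : ℂ)) • A ⟨p.src.shift p.ν, p.μ⟩)) * exp (-((Complex.I * (η : ℂ)) • A ⟨p.src, p.ν⟩)))))))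
    (hgrad : ∀ A δ : PBond P 0 → Matrix (Fin 2) (Fin 2) ℂ, fderiv ℂ (fun A : PBond P 0 → Matrix (Fin 2) (Fin 2) ℂ => (∑ p : Plaq P 0, (1 - (2 : ℂ)⁻¹ * Matrix.trace (exp ((Complex.I * (η : ℂ)) • A ⟨p.src, p.μ⟩) * exp ((Complex.I * (η : ℂ)) • A ⟨p.src.shift p.μ, p.ν⟩) * exp (-((Complex.I * (η : ℂ)) • A ⟨p.src.shift p.ν, p.μ⟩)) * exp (-((Complex.I * (η : ℂ)) • A ⟨p.src, p.ν⟩)))))) A δ =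
      ((η : ℂ) ^ 2 / 2) * ∑ p : Plaq P 0, Matrix.trace ((A ⟨p.src, p.μ⟩ + A ⟨p.src.shift p.μ, p.ν⟩ - A ⟨p.src.shift p.ν, p.μ⟩ - A ⟨p.src, p.ν⟩) * (δ ⟨p.src, p.μ⟩ + δ ⟨p.src.shift p.μ, p.ν⟩ - δ ⟨p.src.shift p.ν, p.μ⟩ - δ ⟨p.src, p.ν⟩)) + (η : ℂ) ^ 4 * ∑ b : PBond P 0, Matrix.trace (W₀ A b * δ b))
    (H : (β' → Matrix (Fin 2) (Fin 2) ℂ) →ₗ[ℂ] (PBond P 0 → Matrix (Fin 2) (Fin 2) ℂ))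
    (D : (PBond P 0 → Matrix (Fin 2) (Fin 2) ℂ) → (β' → Matrix (Fin 2) (Fin 2) ℂ))
    (E : (PBond P 0 → Matrix (Fin 2) (Fin 2) ℂ) → (PBond P 0 → Matrix (Fin 2) (Fin 2) ℂ))
    (hE : ∀ (Y : PBond P 0 → Matrix (Fin 2) (Fin 2) ℂ) (b : PBond P 0) (i j : Fin 2), E Y b i j = ((η : ℂ) ^ 4)⁻¹ *
      (-(((η : ℂ) ^ 2 / 2) * ∑ p : Plaq P 0, Matrix.trace ((H (D Y) ⟨p.src, p.μ⟩ + H (D Y) ⟨p.src.shift p.μ, p.ν⟩ - H (D Y) ⟨p.src.shift p.ν, p.μ⟩ - H (D Y) ⟨p.src, p.ν⟩) *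
          ((Pi.single b (Matrix.single j i (1 : ℂ)) : PBond P 0 → Matrix (Fin 2) (Fin 2) ℂ) ⟨p.src, p.μ⟩ + (Pi.single b (Matrix.single j i (1 : ℂ)) : PBond P 0 → Matrix (Fin 2) (Fin 2) ℂ) ⟨p.src.shift p.μ, p.ν⟩ -
            (Pi.single b (Matrix.single j i (1 : ℂ)) : PBond P 0 → Matrix (Fin 2) (Fin 2) ℂ) ⟨p.src.shift p.ν, p.μ⟩ - (Pi.single b (Matrix.single j i (1 : ℂ)) : PBond P 0 → Matrix (Fin 2) (Fin 2) ℂ) ⟨p.src, p.ν⟩)))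
        - ((η : ℂ) ^ 2 / 2) * ∑ p : Plaq P 0, Matrix.trace (((Y - H (D Y)) ⟨p.src, p.μ⟩ + (Y - H (D Y)) ⟨p.src.shift p.μ, p.ν⟩ - (Y - H (D Y)) ⟨p.src.shift p.ν, p.μ⟩ - (Y - H (D Y)) ⟨p.src, p.ν⟩) *
          (H (fderiv ℂ D Y (Pi.single b (Matrix.single j i (1 : ℂ)))) ⟨p.src, p.μ⟩ + H (fderiv ℂ D Y (Pi.single b (Matrix.single j i (1 : ℂ)))) ⟨p.src.shift p.μ, p.ν⟩ -
            H (fderiv ℂ D Y (Pi.single b (Matrix.single j i (1 : ℂ)))) ⟨p.src.shift p.ν, p.μ⟩ - H (fderiv ℂ D Y (Pi.single b (Matrix.single j i (1 : ℂ)))) ⟨p.src, p.ν⟩))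
        - (η : ℂ) ^ 4 * ∑ b' : PBond P 0, Matrix.trace (W₀ (Y - H (D Y)) b' * H (fderiv ℂ D Y (Pi.single b (Matrix.single j i (1 : ℂ)))) b')))
    {S₀ : Set (PBond P 0 → Matrix (Fin 2) (Fin 2) ℂ)} {Bdat : BondIdx Dm → Matrix (Fin 2) (Fin 2) ℂ}
    (U : (PBond P 0 → Matrix (Fin 2) (Fin 2) ℂ) → GaugeField P 0 (Matrix.specialUnitaryGroup (Fin 2) ℂ))
    (hΨsa : ∀ X ∈ {X : PBond P 0 → Matrix (Fin 2) (Fin 2) ℂ | (∀ b, IsSelfAdjoint (X b)) ∧ (∀ c : BondIdx Dm, bondAvgIter (c.1.1 : ℕ) X c.1.2 = Bdat c) ∧ X ∈ S₀}, ∀ b, IsSelfAdjoint ((X - H (D X)) b))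
    (hU : ∀ X ∈ {X : PBond P 0 → Matrix (Fin 2) (Fin 2) ℂ | (∀ b, IsSelfAdjoint (X b)) ∧ (∀ c : BondIdx Dm, bondAvgIter (c.1.1 : ℕ) X c.1.2 = Bdat c) ∧ X ∈ S₀}, ∀ b, ((U X b : Matrix.specialUnitaryGroup (Fin 2) ℂ) : Matrix (Fin 2) (Fin 2) ℂ) = exp ((Complex.I * (η : ℂ)) • (X - H (D X)) b))
    {A : PBond P 0 → Matrix (Fin 2) (Fin 2) ℂ} (hAsa : ∀ b, IsSelfAdjoint (A b)) (hAQ : ∀ c : BondIdx Dm, bondAvgIter (c.1.1 : ℕ) A c.1.2 = Bdat c) (hAS : A ∈ S₀)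
    (hS₀ : ∀ δ : PBond P 0 → Matrix (Fin 2) (Fin 2) ℂ, ∃ r : ℝ, 0 < r ∧ ∀ t : ℝ, |t| < r → A + t • δ ∈ S₀)
    (hD : DifferentiableAt ℂ D A)
    (hmin : IsMinOn (fun X => wilsonAction4 (U X)) {X : PBond P 0 → Matrix (Fin 2) (Fin 2) ℂ | (∀ b, IsSelfAdjoint (X b)) ∧ (∀ c : BondIdx Dm, bondAvgIter (c.1.1 : ℕ) X c.1.2 = Bdat c) ∧ X ∈ S₀} A) :
    ∀ s : PBond P 0 → ℝ, QE Dm (WithLp.toLp 2 s) = 0 → ∀ Et : Matrix (Fin 2) (Fin 2) ℂ, IsSelfAdjoint Et →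
    (((η : ℂ) ^ 2 / 2) * ∑ p : Plaq P 0, Matrix.trace ((A ⟨p.src, p.μ⟩ + A ⟨p.src.shift p.μ, p.ν⟩ - A ⟨p.src.shift p.ν, p.μ⟩ - A ⟨p.src, p.ν⟩) * (((s ⟨p.src, p.μ⟩ : ℝ) : ℂ) • Et + ((s ⟨p.src.shift p.μ, p.ν⟩ : ℝ) : ℂ) • Et - ((s ⟨p.src.shift p.ν, p.μ⟩ : ℝ) : ℂ) • Et - ((s ⟨p.src, p.ν⟩ : ℝ) : ℂ) • Et)) +
      (η : ℂ) ^ 4 * ∑ b : PBond P 0, Matrix.trace ((W₀ (A - H (D A)) b + E A b) * (((s b : ℝ) : ℂ) • Et))).re = 0 := by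
  have hmin' : IsMinOn (fun X => ((fun A : PBond P 0 → Matrix (Fin 2) (Fin 2) ℂ => (∑ p : Plaq P 0, (1 - (2 : ℂ)⁻¹ * Matrix.trace (exp ((Complex.I * (η : ℂ)) • A ⟨p.src, p.μ⟩) * exp ((Complex.I * (η : ℂ)) • A ⟨p.src.shift p.μ, p.ν⟩) * exp (-((Complex.I * (η : ℂ)) • A ⟨p.src.shift p.ν, p.μ⟩)) * exp (-((Complex.I * (η : ℂ)) • A ⟨p.src, p.ν⟩)))))) (X - H (D X))).re) {X : PBond P 0 → Matrix (Fin 2) (Fin 2) ℂ | (∀ b, IsSelfAdjoint (X b)) ∧ (∀ c : BondIdx Dm, bondAvgIter (c.1.1 : ℕ) X c.1.2 = Bdat c) ∧ X ∈ S₀} A := by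
    intro X hX
    have hXe := wilsonAction4_eq_re_action η (X - H (D X)) (hΨsa X hX) (U X) (hU X hX)
    have hAe := wilsonAction4_eq_re_action η (A - H (D A)) (hΨsa A ⟨hAsa, hAQ, hAS⟩) (U A) (hU A ⟨hAsa, hAQ, hAS⟩)
    have h := hmin hX
    simp only [Set.mem_setOf_eq] at h ⊢
    rw [← hXe, ← hAe]
    exact h
  exact tracePairing_of_isMinOn_dressed Dm η hη (fun A : PBond P 0 → Matrix (Fin 2) (Fin 2) ℂ => (∑ p : Plaq P 0, (1 - (2 : ℂ)⁻¹ * Matrix.trace (exp ((Complex.I * (η : ℂ)) • A ⟨p.src, p.μ⟩) * exp ((Complex.I * (η : ℂ)) • A ⟨p.src.shift p.μ, p.ν⟩) * exp (-((Complex.I * (η : ℂ)) • A ⟨p.src.shift p.ν, p.μ⟩)) * exp (-((Complex.I * (η : ℂ)) • A ⟨p.src, p.ν⟩)))))) W₀ hSd hgrad H D E hE hAsa hAQ hS₀ hD hmin'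

end Minimality

end Summit.QuantumFields.YangMills.Theorems.HalvingDressedCriticality

end
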